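import Summits.BirchSwinnertonDyer.BirchSwinnertonDyer.Theorems.ManinLocalTwoThreeVertexLeaf
import Summits.BirchSwinnertonDyer.BirchSwinnertonDyer.Theorems.ManinLocalTwoThreeVertexTwo
import Summits.BirchSwinnertonDyer.BirchSwinnertonDyer.Theorems.ManinLocalTwoThreeAtkinLehnerStepHolds
import Summits.BirchSwinnertonDyer.Rank1Residual.ManinAdditive.RelativeIharaShiftVanishingParabolic
import Literature.NumberTheory.EllipticCurves.Gamma0AwayCharacterExtension
import HarnessLib

/-!
# E-es-36o at `t = 2` (`RelativeIharaShiftVanishingParOdd 2 2 n`, every level) from E-es-43 and the index-2 descent E-es-37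

Summit `BirchSwinnertonDyer`, route `ManinLocalTwoThree` (cell bsd-f2-manin), crux C2 `ManinOddAtFour` (stmt-BirchSwinnertonDyer-22967),
line `kato_shift_two` v6, stub 3 `stub_cThreeImageResidual`; MEMO-es §25.11 (b) «k = 0 / k = 1 / k ≥ 2 for t = 2: E-es-43 directly /
vertex step / E-es-37 chain — all L» and §25.12 (4), (6), (11), (12).

The vertex machinery of `Theorems/ManinLocalTwoThreeVertex{Tail,Assembly}.lean` used the full parabolicity of the class only at the two
cusps `∞`, `0`; the descent E-es-37 transports exactly those two cusp conditions (`KillsCuspsZeroInfty`).  So this file first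
re-runs (V-d)/(V-e) and the `k = 0` case under the two-cusp hypothesis, then assembles the `t = 2` leaf:

* `deltaHom_integral_unipotents_of_killsCusps`, `eq_zero_of_vertexInputs_of_killsCusps`,
  `eq_zero_of_deltaCharacterExtension_of_not_dvd_of_killsCusps` — two-cusp forms of the landed parabolic versions.
* **`relativeIharaShiftVanishingParOdd_two_two_of_descent (h43) (h37) (n) : RelativeIharaShiftVanishingParOdd 2 2 n`** — -ty's leaf
  E-es-36o at `(2,2,n)` (every level `L = L′·2^k`, `n` odd) from the Literature fact E-es-43
  `gamma0Away_character_extension_of_shiftInvariant` and the body of es's E-es-37 `ShiftInvariantDescentTwo 2` (index-2 descent, the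
  lead's lane; used for `j ≥ 2` only): `oddShiftReduction` (E-es-38) ∘ induction on `k` — `k ≥ 2` descend, `k = 1` the vertex
  (`shiftInvariantIsOldUpToDiamondMin_two` (p2) + `atkinLehnerStep_holds` + E-es-43 via `eq_zero_of_vertexInputs_of_killsCusps`),
  `k = 0` E-es-43 alone.

No new definitions; nothing about BSD or Manin's conjecture is proved here.

References: G. Shimura (1971) §8.3 [cite: Shimura1971, §8.3 (8.3.2)]; cell memo HOME/MEMO-es.md §25.9–§25.12; HOME/es/Sketch-es-g12.lean.
-/

set_option autoImplicit false
set_option linter.dupNamespace false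

open scoped MatrixGroups

open CongruenceSubgroup Literature.NumberTheory.EllipticCurves.ModularForms
  Literature.NumberTheory.EllipticCurves.ModularForms.HidaCohomology
  Summit.BirchSwinnertonDyer.BirchSwinnertonDyer.Theorems.ConjSpanGenAllLevels
  Summit.BirchSwinnertonDyer.Rank1Residual.ManinAdditive
  Literature.NumberTheory.EllipticCurves

namespace Summit.BirchSwinnertonDyer.BirchSwinnertonDyer.Theorems.ManinLocalTwoThree

noncomputable section

/-! ### §1  Two-cusp forms of (V-d)/(V-e) and of the case `k = 0` -/

section TwoCusps

variable {t L' : ℕ} {K : Type*} [Field K]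

/-- **Cusp values at `∞` and `0` suffice** (two-cusp form of `deltaHom_integral_unipotents_of_parabolic`): `ι(T^m)` fixes `∞`,
`ι(U⁻(N t m))` fixes `0`. [folklore] -/
theorem deltaHom_integral_unipotents_of_killsCusps {N : ℕ} {A : Type*} [AddCommGroup A] (φ : SL(2, Away t) → A)
    (u : Gamma0 (N * t) → Fin 1 → A)
    (hφu : ∀ γ : Gamma0 (N * t), ((γ : SL(2, ℤ)) 0 0 : ℤ) = 1 → ((γ : SL(2, ℤ)) 1 1 : ℤ) = 1 → φ (iota t (γ : SL(2, ℤ))) = u γ 0)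
    (hinf : ∀ γ : Gamma0 (N * t),
      Matrix.SpecialLinearGroup.mapGL ℚ (γ : SL(2, ℤ)) • (OnePoint.infty : OnePoint ℚ) = OnePoint.infty → u γ = 0)
    (hzero : ∀ γ : Gamma0 (N * t),
      Matrix.SpecialLinearGroup.mapGL ℚ (γ : SL(2, ℤ)) • ((0 : ℚ) : OnePoint ℚ) = ((0 : ℚ) : OnePoint ℚ) → u γ = 0) :
    (∀ m : ℤ, φ (upperUnip ((m : ℤ) : Away t)) = 0) ∧
      (∀ m : ℤ, φ (lowerUnip ((N : Away t) * ((t : Away t) * ((m : ℤ) : Away t)))) = 0) := by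
  constructor
  · intro m
    let γ : Gamma0 (N * t) := ⟨ModularGroup.T ^ m, by rw [Gamma0_mem, ModularGroup.coe_T_zpow]; simp⟩
    have e : ((γ : SL(2, ℤ)) : Matrix (Fin 2) (Fin 2) ℤ) = !![1, m; 0, 1] := ModularGroup.coe_T_zpow m
    have e00 : ((γ : SL(2, ℤ)) 0 0 : ℤ) = 1 := by
      show ((γ : SL(2, ℤ)) : Matrix (Fin 2) (Fin 2) ℤ) 0 0 = 1; rw [e]; rfl
    have e01 : ((γ : SL(2, ℤ)) 0 1 : ℤ) = m := by
      show ((γ : SL(2, ℤ)) : Matrix (Fin 2) (Fin 2) ℤ) 0 1 = m; rw [e]; rfl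
    have e10 : ((γ : SL(2, ℤ)) 1 0 : ℤ) = 0 := by
      show ((γ : SL(2, ℤ)) : Matrix (Fin 2) (Fin 2) ℤ) 1 0 = 0; rw [e]; rfl
    have e11 : ((γ : SL(2, ℤ)) 1 1 : ℤ) = 1 := by
      show ((γ : SL(2, ℤ)) : Matrix (Fin 2) (Fin 2) ℤ) 1 1 = 1; rw [e]; rfl
    have hι : iota t (γ : SL(2, ℤ)) = upperUnip ((m : ℤ) : Away t) := by
      ext i j
      rw [ConjSpanGenAllLevels.iota_apply]
      fin_cases i <;> fin_cases j <;> simp [upperUnip, e00, e01, e10, e11]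
    rw [← hι, hφu γ e00 e11]
    have h := hinf γ (by
      rw [OnePoint.smul_infty_eq_self_iff]
      show ((((γ : SL(2, ℤ)) 1 0 : ℤ) : ℚ)) = 0
      rw [e10, Int.cast_zero])
    rw [h]; rfl
  · intro m
    let g : SL(2, ℤ) := ⟨!![1, 0; (N : ℤ) * t * m, 1], by rw [Matrix.det_fin_two_of]; ring⟩
    let γ : Gamma0 (N * t) := ⟨g, by
      rw [Gamma0_mem]
      show ((((N : ℤ) * t * m : ℤ)) : ZMod (N * t)) = 0
      push_cast
      rw [show ((N : ZMod (N * t)) * (t : ZMod (N * t))) = ((N * t : ℕ) : ZMod (N * t)) by push_cast; ring, ZMod.natCast_self,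
        zero_mul]⟩
    have hι : iota t (γ : SL(2, ℤ)) = lowerUnip ((N : Away t) * ((t : Away t) * ((m : ℤ) : Away t))) := by
      ext i j
      rw [ConjSpanGenAllLevels.iota_apply]
      fin_cases i <;> fin_cases j <;> simp [γ, g, lowerUnip]
      ring
    rw [← hι, hφu γ rfl rfl]
    have h := hzero γ (by
      have m10 : ((Matrix.SpecialLinearGroup.mapGL ℚ (γ : SL(2, ℤ)) : GL (Fin 2) ℚ) : Matrix (Fin 2) (Fin 2) ℚ) 1 0 =
          (((N : ℤ) * t * m : ℤ) : ℚ) := rfl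
      have m11 : ((Matrix.SpecialLinearGroup.mapGL ℚ (γ : SL(2, ℤ)) : GL (Fin 2) ℚ) : Matrix (Fin 2) (Fin 2) ℚ) 1 1 =
          ((1 : ℤ) : ℚ) := rfl
      have m00 : ((Matrix.SpecialLinearGroup.mapGL ℚ (γ : SL(2, ℤ)) : GL (Fin 2) ℚ) : Matrix (Fin 2) (Fin 2) ℚ) 0 0 =
          ((1 : ℤ) : ℚ) := rfl
      have m01 : ((Matrix.SpecialLinearGroup.mapGL ℚ (γ : SL(2, ℤ)) : GL (Fin 2) ℚ) : Matrix (Fin 2) (Fin 2) ℚ) 0 1 =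
          ((0 : ℤ) : ℚ) := rfl
      rw [OnePoint.smul_some_eq_ite, m10, m11, m00, m01]
      simp)
    rw [h]; rfl

/-- **The vertex step, assembled, two-cusp form** (as `eq_zero_of_vertexInputs`, with parabolicity replaced by the cusp conditions at
`∞` and `0` — all that (V-d) consumes). [cite: Shimura1971, §8.3 (8.3.2)] -/
theorem eq_zero_of_vertexInputs_of_killsCusps [CharP K 2] [NeZero L'] [NeZero t] (ht : t.Prime) (hL' : ¬ t ∣ L')
    (S : Finset ℕ) (lam : ℕ → K) (u : cocycles 0 (L' * t) K)
    (hS : ∀ q : ℕ, q.Prime → q ∣ L' * t → q ∈ S)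
    (hgen : IsHeckeGenEigenvector S lam u)
    (hNT : ∃ r : ℕ, r.Prime ∧ r ∉ S ∧ lam r ≠ (r : K) + 1)
    (hinf : ∀ γ : Gamma0 (L' * t), Matrix.SpecialLinearGroup.mapGL ℚ (γ : SL(2, ℤ)) • (OnePoint.infty : OnePoint ℚ) =
      OnePoint.infty → (u : Gamma0 (L' * t) → Fin 1 → K) γ = 0)
    (hzero : ∀ γ : Gamma0 (L' * t), Matrix.SpecialLinearGroup.mapGL ℚ (γ : SL(2, ℤ)) • ((0 : ℚ) : OnePoint ℚ) =
      ((0 : ℚ) : OnePoint ℚ) → (u : Gamma0 (L' * t) → Fin 1 → K) γ = 0)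
    (h41 : ∃ (u₀ : cocycles 0 L' K) (ψ : ZMod t → K),
      (u : Gamma0 (L' * t) → Fin 1 → K) =
        degeneracyPullback 0 L' (L' * t) 1 K (by simp) (u₀ : Gamma0 L' → Fin 1 → K) + diamondFun (L' * t) t K ψ)
    (h42 : ∀ h : Gamma0 L', (t : ℤ) ∣ (h : SL(2, ℤ)) 0 0 → ∀ γ β : Gamma0 (L' * t),
      (((h : SL(2, ℤ)) * (γ : SL(2, ℤ)) * (h : SL(2, ℤ))⁻¹) 0 0 = (β : SL(2, ℤ)) 0 0 ∧
        ((h : SL(2, ℤ)) * (γ : SL(2, ℤ)) * (h : SL(2, ℤ))⁻¹) 0 1 = (t : ℤ) * (β : SL(2, ℤ)) 0 1 ∧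
        (t : ℤ) * ((h : SL(2, ℤ)) * (γ : SL(2, ℤ)) * (h : SL(2, ℤ))⁻¹) 1 0 = (β : SL(2, ℤ)) 1 0 ∧
        ((h : SL(2, ℤ)) * (γ : SL(2, ℤ)) * (h : SL(2, ℤ))⁻¹) 1 1 = (β : SL(2, ℤ)) 1 1) →
      (u : Gamma0 (L' * t) → Fin 1 → K) β = (u : Gamma0 (L' * t) → Fin 1 → K) γ)
    (h43 : ∀ u₀ : cocycles 0 L' K,
      degeneracyPullback 0 L' (L' * t) t K dvd_rfl (u₀ : Gamma0 L' → Fin 1 → K) =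
        degeneracyPullback 0 L' (L' * t) 1 K (by simp) (u₀ : Gamma0 L' → Fin 1 → K) →
      ∃ Φ : SL(2, Away t) → K,
        (∀ g ∈ Delta t L', ∀ g' ∈ Delta t L', Φ (g * g') = Φ g + Φ g') ∧
        ∀ γ : Gamma0 L', Φ (iota t (γ : SL(2, ℤ))) = (u₀ : Gamma0 L' → Fin 1 → K) γ 0) :
    u = 0 := by
  obtain ⟨u₀, ψ, hdec⟩ := h41
  have hcop : Nat.Coprime t L' := (Nat.Prime.coprime_iff_not_dvd ht).2 hL'
  obtain ⟨h₀, hh₀⟩ := exists_Gamma0_dvd_apply_zero_zero hcop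
  have hshift₀ := shiftInvariant_base_of_atkinLehner hcop u u₀ ψ hdec h42 h₀ hh₀
  obtain ⟨Φ, hΦadd, hΦι⟩ := h43 u₀ hshift₀
  have hφu : ∀ γ : Gamma0 (L' * t), ((γ : SL(2, ℤ)) 0 0 : ℤ) = 1 → ((γ : SL(2, ℤ)) 1 1 : ℤ) = 1 →
      Φ (iota t (γ : SL(2, ℤ))) = (u : Gamma0 (L' * t) → Fin 1 → K) γ 0 := by
    intro γ _ h11
    have e := dec_apply u u₀ ψ hdec γ
    rw [h11, Int.cast_one, psi_one u u₀ ψ hdec, add_zero] at e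
    rw [e, ← hΦι (Gamma0.degeneracyConj L' (L' * t) 1 (by simp) γ), Gamma0.coe_degeneracyConj_one]
  obtain ⟨hU, hL⟩ := deltaHom_integral_unipotents_of_killsCusps Φ (u : Gamma0 (L' * t) → Fin 1 → K) hφu hinf hzero
  obtain ⟨η, hη, hηι⟩ :=
    exists_diamond_of_deltaHom_of_integral_mul (M := L' * t) ht.two_le (Dvd.intro _ rfl) Φ hΦadd hU hL
  have hL'd : L' ∣ L' * t := Dvd.intro _ rfl
  have htd : t ∣ L' * t := Dvd.intro_left _ rfl
  let θ : ZMod (L' * t) → K := fun x => η (ZMod.castHom hL'd (ZMod L') x) + ψ (ZMod.castHom htd (ZMod t) x)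
  have hdiam : (u : Gamma0 (L' * t) → Fin 1 → K) = diamondFun (L' * t) (L' * t) K θ := by
    funext γ i
    obtain rfl : i = 0 := Fin.eq_zero i
    rw [diamondFun_apply, dec_apply u u₀ ψ hdec γ, ← hΦι (Gamma0.degeneracyConj L' (L' * t) 1 (by simp) γ),
      Gamma0.coe_degeneracyConj_one, hηι γ]
    simp only [θ, map_intCast]
  have hθ : ∀ a b : ZMod (L' * t), IsUnit a → IsUnit b → θ (a * b) = θ a + θ b := by
    intro a b ha hb
    obtain ⟨γa, hγa, hγa'⟩ := exists_mem_Gamma0_apply_one_one_eq ha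
    obtain ⟨γb, hγb, hγb'⟩ := exists_mem_Gamma0_apply_one_one_eq hb
    have hψab : ψ (ZMod.castHom htd (ZMod t) (a * b)) =
        ψ (ZMod.castHom htd (ZMod t) a) + ψ (ZMod.castHom htd (ZMod t) b) := by
      rw [← hγa', ← hγb', ← Int.cast_mul, map_intCast, map_intCast, map_intCast, Int.cast_mul]
      have := psi_mul u u₀ ψ hdec ⟨γa, hγa⟩ ⟨γb, hγb⟩
      rw [gamma0_d_mul_cast htd] at this
      exact this
    simp only [θ, map_mul]
    rw [hη _ _ (ha.map _) (hb.map _), ← map_mul, hψab]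
    abel
  obtain ⟨r, hr, hrS, hne⟩ := hNT
  haveI : NeZero r := ⟨hr.ne_zero⟩
  have hrM : ¬ r ∣ L' * t := fun h => hrS (hS r hr h)
  exact eq_zero_of_coe_eq_diamondFun_of_ne dvd_rfl u θ hθ hdiam hr hrM (hgen r hr hrS) hne

/-- **The case `k = v_t(L) = 0`, two-cusp form** (as `eq_zero_of_deltaCharacterExtension_of_not_dvd`, whose `h43` binder moreover
has a slip — `u` for `u₀` in its last clause — corrected here; this version supersedes it). [cite: Shimura1971, §8.3 (8.3.2)] -/
theorem eq_zero_of_deltaCharacterExtension_of_not_dvd_of_killsCusps {L : ℕ} [NeZero L] [NeZero t] (ht : t.Prime)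
    (S : Finset ℕ) (lam : ℕ → K) (u : cocycles 0 L K)
    (hS : ∀ q : ℕ, q.Prime → q ∣ L → q ∈ S)
    (hgen : IsHeckeGenEigenvector S lam u)
    (hNT : ∃ r : ℕ, r.Prime ∧ r ∉ S ∧ lam r ≠ (r : K) + 1)
    (hinf : ∀ γ : Gamma0 L, Matrix.SpecialLinearGroup.mapGL ℚ (γ : SL(2, ℤ)) • (OnePoint.infty : OnePoint ℚ) =
      OnePoint.infty → (u : Gamma0 L → Fin 1 → K) γ = 0)
    (hzero : ∀ γ : Gamma0 L, Matrix.SpecialLinearGroup.mapGL ℚ (γ : SL(2, ℤ)) • ((0 : ℚ) : OnePoint ℚ) =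
      ((0 : ℚ) : OnePoint ℚ) → (u : Gamma0 L → Fin 1 → K) γ = 0)
    (hshift : degeneracyPullback 0 L (L * t) t K dvd_rfl (u : Gamma0 L → Fin 1 → K) =
      degeneracyPullback 0 L (L * t) 1 K (by simp) (u : Gamma0 L → Fin 1 → K))
    (h43 : ∀ u₀ : cocycles 0 L K,
      degeneracyPullback 0 L (L * t) t K dvd_rfl (u₀ : Gamma0 L → Fin 1 → K) =
        degeneracyPullback 0 L (L * t) 1 K (by simp) (u₀ : Gamma0 L → Fin 1 → K) →
      ∃ Φ : SL(2, Away t) → K,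
        (∀ g ∈ Delta t L, ∀ g' ∈ Delta t L, Φ (g * g') = Φ g + Φ g') ∧
        ∀ γ : Gamma0 L, Φ (iota t (γ : SL(2, ℤ))) = (u₀ : Gamma0 L → Fin 1 → K) γ 0) :
    u = 0 := by
  obtain ⟨Φ, hΦadd, hΦι⟩ := h43 u hshift
  let u' : Gamma0 (L * t) → Fin 1 → K := degeneracyPullback 0 L (L * t) 1 K (by simp) (u : Gamma0 L → Fin 1 → K)
  have hu' : ∀ γ : Gamma0 (L * t), u' γ = (u : Gamma0 L → Fin 1 → K) (Gamma0.degeneracyConj L (L * t) 1 (by simp) γ) :=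
    fun γ => degeneracyPullback_zero_apply _ _ γ
  have hφu : ∀ γ : Gamma0 (L * t), ((γ : SL(2, ℤ)) 0 0 : ℤ) = 1 → ((γ : SL(2, ℤ)) 1 1 : ℤ) = 1 →
      Φ (iota t (γ : SL(2, ℤ))) = u' γ 0 := by
    intro γ _ _
    rw [hu', ← hΦι (Gamma0.degeneracyConj L (L * t) 1 (by simp) γ), Gamma0.coe_degeneracyConj_one]
  have hinf' : ∀ γ : Gamma0 (L * t), Matrix.SpecialLinearGroup.mapGL ℚ (γ : SL(2, ℤ)) • (OnePoint.infty : OnePoint ℚ) =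
      OnePoint.infty → u' γ = 0 := by
    intro γ hγ
    rw [hu']
    refine hinf _ ?_
    rw [Gamma0.coe_degeneracyConj_one]; exact hγ
  have hzero' : ∀ γ : Gamma0 (L * t), Matrix.SpecialLinearGroup.mapGL ℚ (γ : SL(2, ℤ)) • ((0 : ℚ) : OnePoint ℚ) =
      ((0 : ℚ) : OnePoint ℚ) → u' γ = 0 := by
    intro γ hγ
    rw [hu']
    refine hzero _ ?_
    rw [Gamma0.coe_degeneracyConj_one]; exact hγ
  obtain ⟨hU, hL⟩ := deltaHom_integral_unipotents_of_killsCusps Φ u' hφu hinf' hzero'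
  obtain ⟨η, hη, hηι⟩ := exists_diamond_of_deltaHom_of_integral_mul (M := L) ht.two_le dvd_rfl Φ hΦadd hU hL
  have hdiam : (u : Gamma0 L → Fin 1 → K) = diamondFun L L K η := by
    funext γ i
    obtain rfl : i = 0 := Fin.eq_zero i
    rw [diamondFun_apply, ← hΦι γ, hηι γ]
  obtain ⟨r, hr, hrS, hne⟩ := hNT
  haveI : NeZero r := ⟨hr.ne_zero⟩
  have hrM : ¬ r ∣ L := fun h => hrS (hS r hr h)
  exact eq_zero_of_coe_eq_diamondFun_of_ne dvd_rfl u η hη hdiam hr hrM (hgen r hr hrS) hne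

end TwoCusps

/-! ### §2  The `t = 2` leaf from E-es-43 and the descent E-es-37 -/

section TwoLeaf

/-- **E-es-36o at `(2,2,n)` — `RelativeIharaShiftVanishingParOdd 2 2 n` for every level — from E-es-43 (Literature fact) and
the index-2 descent E-es-37 (body of `EsG12.ShiftInvariantDescentTwo 2`, defs unfolded; used for `j ≥ 2`)**: write `L = L′·2^k`
with `L′` odd; `oddShiftReduction` makes the class `2`-shift-invariant; for `k ≥ 2` descend (E-es-37) — the class is the
restriction of a class one level down with the same properties; at `k = 1` the vertex (`shiftInvariantIsOldUpToDiamondMin_two`,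
`atkinLehnerStep_holds`, E-es-43, `eq_zero_of_vertexInputs_of_killsCusps`); at `k = 0` E-es-43 alone
(`eq_zero_of_deltaCharacterExtension_of_not_dvd_of_killsCusps`). [cite: Shimura1971, §8.3 (8.3.2)] -/
theorem relativeIharaShiftVanishingParOdd_two_two_of_descent
    (h43 : gamma0Away_character_extension_of_shiftInvariant)
    (h37 : ∀ (K : Type) [Field K] [CharP K 2] (L' j : ℕ) [NeZero L'], ¬ 2 ∣ L' → 1 ≤ j →
      ∀ (S : Finset ℕ) (lam : ℕ → K) (u : cocycles 0 (L' * 2 ^ j) K),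
        (∀ q : ℕ, q.Prime → q ∣ 2 * 2 * L' → q ∈ S) →
        IsHeckeGenEigenvector S lam u →
        (∀ M : ℕ, ∃ r : ℕ, r.Prime ∧ r ∉ S ∧ r ≡ 1 [MOD 2 ^ M] ∧ lam r ≠ (r : K) + 1) →
        ((∀ γ : Gamma0 (L' * 2 ^ j), Matrix.SpecialLinearGroup.mapGL ℚ (γ : SL(2, ℤ)) • (OnePoint.infty : OnePoint ℚ) =
              OnePoint.infty → (u : Gamma0 (L' * 2 ^ j) → Fin 1 → K) γ = 0) ∧
          (∀ γ : Gamma0 (L' * 2 ^ j), Matrix.SpecialLinearGroup.mapGL ℚ (γ : SL(2, ℤ)) • ((0 : ℚ) : OnePoint ℚ) =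
              ((0 : ℚ) : OnePoint ℚ) → (u : Gamma0 (L' * 2 ^ j) → Fin 1 → K) γ = 0)) →
        degeneracyPullback 0 (L' * 2 ^ j) (L' * 2 ^ j * 2) 2 K dvd_rfl (u : Gamma0 (L' * 2 ^ j) → Fin 1 → K) =
          degeneracyPullback 0 (L' * 2 ^ j) (L' * 2 ^ j * 2) 1 K (by simp) (u : Gamma0 (L' * 2 ^ j) → Fin 1 → K) →
        ∃! u' : cocycles 0 (L' * 2 ^ (j - 1)) K,
          degeneracyPullback 0 (L' * 2 ^ (j - 1)) (L' * 2 ^ j) 1 K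
              (by rw [mul_one]; exact Nat.mul_dvd_mul_left L' (Nat.pow_dvd_pow 2 (Nat.sub_le j 1)))
              (u' : Gamma0 (L' * 2 ^ (j - 1)) → Fin 1 → K) = (u : Gamma0 (L' * 2 ^ j) → Fin 1 → K) ∧
          degeneracyPullback 0 (L' * 2 ^ (j - 1)) (L' * 2 ^ (j - 1) * 2) 2 K dvd_rfl
              (u' : Gamma0 (L' * 2 ^ (j - 1)) → Fin 1 → K) =
            degeneracyPullback 0 (L' * 2 ^ (j - 1)) (L' * 2 ^ (j - 1) * 2) 1 K (by simp)
              (u' : Gamma0 (L' * 2 ^ (j - 1)) → Fin 1 → K) ∧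
          IsHeckeGenEigenvector S lam u' ∧
          ((∀ γ : Gamma0 (L' * 2 ^ (j - 1)), Matrix.SpecialLinearGroup.mapGL ℚ (γ : SL(2, ℤ)) • (OnePoint.infty : OnePoint ℚ) =
                OnePoint.infty → (u' : Gamma0 (L' * 2 ^ (j - 1)) → Fin 1 → K) γ = 0) ∧
            (∀ γ : Gamma0 (L' * 2 ^ (j - 1)), Matrix.SpecialLinearGroup.mapGL ℚ (γ : SL(2, ℤ)) • ((0 : ℚ) : OnePoint ℚ) =
                ((0 : ℚ) : OnePoint ℚ) → (u' : Gamma0 (L' * 2 ^ (j - 1)) → Fin 1 → K) γ = 0)))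
    (n : ℕ) : RelativeIharaShiftVanishingParOdd 2 2 n := by
  intro h2 _ hn K _ _ L _ _ S lam u hS hgen hNT hpar hshift
  classical
  -- `2ⁿ`-shift ⟹ `2`-shift
  have hshift1 := oddShiftReduction 2 2 n h2 h2 hn K L S lam u hS hgen hNT hshift
  -- `L = L′ · 2^k`, `L′` odd
  obtain ⟨k, L', hL', rfl⟩ : ∃ k L' : ℕ, ¬ 2 ∣ L' ∧ L = L' * 2 ^ k :=
    ⟨L.factorization 2, L / 2 ^ L.factorization 2, Nat.not_dvd_ordCompl Nat.prime_two (NeZero.ne L),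
      ((Nat.ordProj_mul_ordCompl_eq_self L 2).symm.trans (mul_comm _ _))⟩
  haveI : NeZero L' := ⟨fun h => NeZero.ne (L' * 2 ^ k) (by rw [h, zero_mul])⟩
  -- E-es-43 at `t = 2` in the `Delta`/`iota` spelling, any level prime to `2`
  have h43' : ∀ (M : ℕ) [NeZero M], ¬ 2 ∣ M → ∀ u₀ : cocycles 0 M K,
      degeneracyPullback 0 M (M * 2) 2 K dvd_rfl (u₀ : Gamma0 M → Fin 1 → K) =
        degeneracyPullback 0 M (M * 2) 1 K (by simp) (u₀ : Gamma0 M → Fin 1 → K) →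
      ∃ Φ : SL(2, Away 2) → K,
        (∀ g ∈ Delta 2 M, ∀ g' ∈ Delta 2 M, Φ (g * g') = Φ g + Φ g') ∧
        ∀ γ : Gamma0 M, Φ (iota 2 (γ : SL(2, ℤ))) = (u₀ : Gamma0 M → Fin 1 → K) γ 0 := by
    intro M _ hM u₀ hsh
    obtain ⟨Φ, hadd, hι⟩ := h43 2 h2 K M hM u₀ hsh
    exact ⟨Φ, fun g hg g' hg' => hadd g hg g' hg', hι⟩
  -- the statement at level `L′ · 2^k`, by induction on `k`, for all `S`, `λ`, `u` with the two cusp conditions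
  have main : ∀ (k : ℕ) (S : Finset ℕ) (lam : ℕ → K) (u : cocycles 0 (L' * 2 ^ k) K),
      (∀ q : ℕ, q.Prime → q ∣ 2 * 2 * (L' * 2 ^ k) → q ∈ S) →
      IsHeckeGenEigenvector S lam u →
      (∀ M : ℕ, ∃ r : ℕ, r.Prime ∧ r ∉ S ∧ r ≡ 1 [MOD 2 ^ M] ∧ lam r ≠ (r : K) + 1) →
      (∀ γ : Gamma0 (L' * 2 ^ k), Matrix.SpecialLinearGroup.mapGL ℚ (γ : SL(2, ℤ)) • (OnePoint.infty : OnePoint ℚ) =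
          OnePoint.infty → (u : Gamma0 (L' * 2 ^ k) → Fin 1 → K) γ = 0) →
      (∀ γ : Gamma0 (L' * 2 ^ k), Matrix.SpecialLinearGroup.mapGL ℚ (γ : SL(2, ℤ)) • ((0 : ℚ) : OnePoint ℚ) =
          ((0 : ℚ) : OnePoint ℚ) → (u : Gamma0 (L' * 2 ^ k) → Fin 1 → K) γ = 0) →
      degeneracyPullback 0 (L' * 2 ^ k) (L' * 2 ^ k * 2) 2 K dvd_rfl (u : Gamma0 (L' * 2 ^ k) → Fin 1 → K) =
        degeneracyPullback 0 (L' * 2 ^ k) (L' * 2 ^ k * 2) 1 K (by simp) (u : Gamma0 (L' * 2 ^ k) → Fin 1 → K) →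
      u = 0 := by
    intro k
    induction k with
    | zero =>
      intro S lam u hS hgen hNT hinf hzero hsh
      have hL0 : ¬ 2 ∣ L' * 2 ^ 0 := by simpa using hL'
      obtain ⟨r, hr, hrS, -, hne⟩ := hNT 0
      exact eq_zero_of_deltaCharacterExtension_of_not_dvd_of_killsCusps (t := 2) Nat.prime_two S lam u
        (fun q hq hqd => hS q hq (hqd.trans (Dvd.intro_left _ rfl))) hgen ⟨r, hr, hrS, hne⟩ hinf hzero hsh
        (h43' (L' * 2 ^ 0) hL0)
    | succ k ih =>
      intro S lam u hS hgen hNT hinf hzero hsh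
      rcases Nat.eq_zero_or_pos k with hk | hk
      · -- `k + 1 = 1`: the vertex
        subst hk
        have hS' : ∀ q : ℕ, q.Prime → q ∣ L' * 2 → q ∈ S :=
          fun q hq hqd => hS q hq (hqd.trans ⟨4, by ring⟩)
        have hS'' : ∀ q : ℕ, q.Prime → q ∣ 2 * 2 * L' → q ∈ S :=
          fun q hq hqd => hS q hq (hqd.trans ⟨2, by ring⟩)
        obtain ⟨r, hr, hrS, -, hne⟩ := hNT 0
        exact eq_zero_of_vertexInputs_of_killsCusps (t := 2) (L' := L') Nat.prime_two hL' S lam u hS' hgen ⟨r, hr, hrS, hne⟩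
          hinf hzero (shiftInvariantIsOldUpToDiamondMin_two (p := 2) (by decide) h2 h2 K L' hL' u hsh)
          (atkinLehnerStep_holds 2 2 h2 h2 K L' hL' S lam u hS'' hgen hNT ⟨hinf, hzero⟩ hsh) (h43' L' hL')
      · -- `k + 1 ≥ 2`: descend
        have hS'' : ∀ q : ℕ, q.Prime → q ∣ 2 * 2 * L' → q ∈ S :=
          fun q hq hqd => hS q hq (hqd.trans ⟨2 ^ (k + 1), by ring⟩)
        obtain ⟨u', ⟨hres, hsh', hgen', hinf', hzero'⟩, -⟩ :=
          h37 K L' (k + 1) hL' (Nat.succ_le_succ (Nat.zero_le k)) S lam u hS'' hgen hNT ⟨hinf, hzero⟩ hsh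
        have hu' : u' = 0 :=
          ih S lam u' (fun q hq hqd => hS q hq (hqd.trans ⟨2, by ring⟩)) hgen' hNT hinf' hzero' hsh'
        apply Subtype.ext
        rw [← hres, hu']
        exact map_zero _
  exact main k S lam u hS hgen hNT (fun γ hγ => hpar γ _ hγ) (fun γ hγ => hpar γ _ hγ) hshift1

end TwoLeaf

end

end Summit.BirchSwinnertonDyer.BirchSwinnertonDyer.Theorems.ManinLocalTwoThree
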